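import Mathlib
import Literature.Combinatorics.ZeroPatterns
import HarnessLib

/-!
# Counting polynomials with restricted coefficients in the image of a polynomial map, and hitting
# sets for finite classes (Chatterjee–Kumar–Ramya–Saptharishi–Tengse 2020, Claims 3.10–3.11 / Cor. 4.2)

Topic `Literature/Computability/AlgebraicComplexity`. Two generic counting steps of the
"non-explicit hitting sets" arguments of Forbes' thesis [F14, Lemmas 3.1.6, 3.2.13–3.2.14] as used by
CKRST 2020 (§3–§5):

* `RestrictedImage.card_realised_le` — **coefficient vectors with entries in a finite set `Δ`
  that are values of a polynomial map `U : F^r → F^M` with coordinates of degree `≤ δ` number at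
  most `(|M|·|Δ|·δ + 1)^r`** (CKRST 2020, Cor. 4.2 / v2 ‹Cor 22›: "the number of polynomials with
  coefficients in `Δ` that are [in the image] is at most `(|Δ|·s)^{poly(s)}`"; printed via the
  degree of varieties [HY11a]; here: such a vector is determined by the zero-pattern of the family
  `{U_μ - z : μ ∈ M, z ∈ Δ}` at a preimage, and zero-patterns are counted by
  Rónyai–Babai–Ganapathy, `Literature.Combinatorics.RBG.card_patterns_le_pow`).
* `FiniteClass.exists_hittingSet` — **a finite class `𝒞` of nonzero `n`-variate polynomials of
  degree `≤ d` has a hitting set of `t` points of `Sⁿ` as soon as `#𝒞 · d^t < |S|^t`** (CKRST 2020,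
  Claim 3.11 = [F14, Lemma 3.2.13]: "a finite class of degree `< d` over `|𝔽| ≥ (1+ε)d` has a
  hitting set of size `⌈log_{1+ε} |𝒞|⌉`"; union bound over `𝒞` of Schwartz–Zippel on the grid).

## References

* [ChatterjeeKumarRamyaSaptharishiTengse2020] arXiv v4 Claims 3.10–3.11, Cor. 4.2 (ECCC TR20-063);
  v2 ‹Cor 22›. locator: paper:arxiv-2004.14147 p0013.txt:L25–L34, p0014.txt:L44.
* [RonyaiBabaiGanapathy2001] Thm. 1.1.
* M. Forbes, PhD thesis (MIT 2014), Lemmas 3.1.6, 3.2.13, 3.2.14 (as cited by CKRST).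
-/

noncomputable section

open MvPolynomial Finset

namespace Literature.Computability.AlgebraicComplexity

/-! ### §1 Vectors with entries in `Δ` realised by a polynomial map -/

namespace RestrictedImage

variable {F : Type*} [Field F] {M : Type*} [Fintype M] [DecidableEq M] {r : ℕ}

open scoped Classical in
/-- **CKRST 2020, Cor. 4.2 / v2 ‹Cor 22› (pattern-count form).** For a polynomial map
`U : F^r → F^M` with coordinates of total degree `≤ δ` and a finite `Δ ⊆ F`, the vectors
`v ∈ Δ^M` of the form `v = U(y)` number at most `(|M|·|Δ|·δ + 1)^r`.
[cite: ChatterjeeKumarRamyaSaptharishiTengse2020, Cor. 4.2 (arXiv v4) = v2 ‹Cor 22›] -/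
theorem card_realised_le (U : M → MvPolynomial (Fin r) F) {δ : ℕ}
    (hδ : ∀ μ, (U μ).totalDegree ≤ δ) (Δ : Finset F) :
    ((Fintype.piFinset fun _ : M => Δ).filter
        (fun v : M → F => ∃ y : Fin r → F, ∀ μ, eval y (U μ) = v μ)).card ≤
      (Fintype.card M * Δ.card * δ + 1) ^ r := by
  classical
  -- the family `U_μ - z`, `μ ∈ M`, `z ∈ Δ`
  let fam : M × Δ → MvPolynomial (Fin r) F := fun q => U q.1 - C (q.2 : F)
  have hdeg : ∑ q, (fam q).totalDegree ≤ Fintype.card M * Δ.card * δ := by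
    calc ∑ q, (fam q).totalDegree ≤ ∑ _q : M × Δ, δ := by
          refine Finset.sum_le_sum fun q _ => ?_
          refine (totalDegree_sub _ _).trans (max_le (hδ q.1) ?_)
          rw [totalDegree_C]; exact Nat.zero_le _
      _ = Fintype.card M * Δ.card * δ := by
          rw [Finset.sum_const, Finset.card_univ, Fintype.card_prod, smul_eq_mul,
            Fintype.card_coe]
  set V := (Fintype.piFinset fun _ : M => Δ).filter
      (fun v : M → F => ∃ y : Fin r → F, ∀ μ, eval y (U μ) = v μ) with hV
  -- witnesses and patterns
  have hw : ∀ v : V, ∃ y : Fin r → F, ∀ μ, eval y (U μ) = v.1 μ := fun v =>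
    (Finset.mem_filter.mp v.2).2
  choose y hy using hw
  let Φ : V → Finset (M × Δ) := fun v => Literature.Combinatorics.RBG.supportPattern fam (y v)
  have hΦmem : ∀ (v : V) (μ : M) (z : Δ),
      (μ, z) ∈ Φ v ↔ v.1 μ ≠ (z : F) := by
    intro v μ z
    simp only [Φ, Literature.Combinatorics.RBG.mem_supportPattern, fam, map_sub, eval_C, hy v μ]
    exact sub_ne_zero
  have hΦinj : Function.Injective Φ := by
    intro v v' h
    apply Subtype.ext
    funext μ
    have hvΔ : v.1 μ ∈ Δ := Fintype.mem_piFinset.mp (Finset.mem_filter.mp v.2).1 μ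
    have h1 : (μ, (⟨v.1 μ, hvΔ⟩ : Δ)) ∉ Φ v := by
      rw [hΦmem]; exact fun h => h rfl
    rw [h, hΦmem, not_not] at h1
    exact h1.symm
  calc V.card = Fintype.card V := (Fintype.card_coe V).symm
    _ ≤ (Literature.Combinatorics.RBG.patterns fam).card := by
        rw [← Fintype.card_coe]
        refine Fintype.card_le_of_injective (fun v => ⟨Φ v, ?_⟩) fun v v' h => hΦinj ?_
        · exact Literature.Combinatorics.RBG.supportPattern_mem_patterns fam (y v)
        · exact congrArg Subtype.val h
    _ ≤ (Fintype.card M * Δ.card * δ + 1) ^ Fintype.card (Fin r) :=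
        Literature.Combinatorics.RBG.card_patterns_le_pow fam hdeg
    _ = (Fintype.card M * Δ.card * δ + 1) ^ r := by rw [Fintype.card_fin]

end RestrictedImage

/-! ### §2 Hitting sets for finite classes -/

namespace FiniteClass

variable {F : Type*} [Field F] {n : ℕ}

/-- Schwartz–Zippel in product form on the grid `Sⁿ`: `#zeros · |S| ≤ d · |S|ⁿ` for a nonzero `g`
of degree `≤ d`. [folklore] -/
private theorem card_zeros_mul_le [DecidableEq F] {g : MvPolynomial (Fin n) F} (hg : g ≠ 0)
    {d : ℕ} (hd : g.totalDegree ≤ d) (S : Finset F) :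
    ((Fintype.piFinset fun _ : Fin n => S).filter (fun a => eval a g = 0)).card * S.card ≤
      d * S.card ^ n := by
  -- adapted from HittingSetsExist.lean
  rcases S.eq_empty_or_nonempty with hS0 | hS
  · rw [hS0, Finset.card_empty, mul_zero]; exact Nat.zero_le _
  have hSpos : (0 : ℚ≥0) < S.card := by exact_mod_cast hS.card_pos
  have h := schwartz_zippel_totalDegree hg S
  rw [div_le_div_iff₀ (by positivity) hSpos] at h
  have h' : (((Fintype.piFinset fun _ : Fin n => S).filter (fun a => eval a g = 0)).card : ℚ≥0) *
      S.card ≤ d * (S.card : ℚ≥0) ^ n :=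
    h.trans (by gcongr)
  exact_mod_cast h'

/-- **CKRST 2020, Claim 3.11 ([F14, Lemma 3.2.13]), counting form: hitting sets for a finite
class.** If `𝒞` is a finite set of NONZERO `n`-variate polynomials of total degree `≤ d` and
`#𝒞 · d^t < |S|^t` for a finite `S ⊆ F`, then some `t` points of `Sⁿ` hit every member of `𝒞`.
(Union bound: a point of `Sⁿ` is a root of a fixed member with "probability" `≤ d/|S|`.)
[cite: ChatterjeeKumarRamyaSaptharishiTengse2020, Claim 3.11 (arXiv v4) = [F14, Lemma 3.2.13]] -/
theorem exists_hittingSet (𝒞 : Finset (MvPolynomial (Fin n) F)) {d t : ℕ}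
    (h0 : ∀ f ∈ 𝒞, f ≠ 0) (hd : ∀ f ∈ 𝒞, f.totalDegree ≤ d) (S : Finset F)
    (hcount : 𝒞.card * d ^ t < S.card ^ t) :
    ∃ H : Finset (Fin n → F), (∀ a ∈ H, ∀ i, a i ∈ S) ∧ H.card ≤ t ∧
      ∀ f ∈ 𝒞, ∃ a ∈ H, eval a f ≠ 0 := by
  classical
  set G : Finset (Fin n → F) := Fintype.piFinset fun _ : Fin n => S with hG
  have hGcard : G.card = S.card ^ n := by
    rw [hG, Fintype.card_piFinset, Finset.prod_const, Finset.card_univ, Fintype.card_fin]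
  let zeros : MvPolynomial (Fin n) F → Finset (Fin n → F) := fun f => G.filter fun a => eval a f = 0
  let Ω : Finset (Fin t → (Fin n → F)) := Fintype.piFinset fun _ : Fin t => G
  let bad : Finset (Fin t → (Fin n → F)) := 𝒞.biUnion fun f => Fintype.piFinset fun _ : Fin t => zeros f
  have hzeros : ∀ f ∈ 𝒞, (zeros f).card * S.card ≤ d * S.card ^ n := fun f hf => by
    simp only [zeros]; rw [hG]; exact card_zeros_mul_le (h0 f hf) (hd f hf) S
  have hΩ : Ω.card = (S.card ^ n) ^ t := by
    simp only [Ω]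
    rw [Fintype.card_piFinset, Finset.prod_const, Finset.card_univ, Fintype.card_fin, hGcard]
  have hbad : bad.card < Ω.card := by
    have h1 : bad.card ≤ ∑ f ∈ 𝒞, (zeros f).card ^ t := by
      refine Finset.card_biUnion_le.trans (Finset.sum_le_sum fun f _ => ?_)
      rw [Fintype.card_piFinset, Finset.prod_const, Finset.card_univ, Fintype.card_fin]
    have h3 : bad.card * S.card ^ t ≤ 𝒞.card * (d * S.card ^ n) ^ t := by
      calc bad.card * S.card ^ t ≤ (∑ f ∈ 𝒞, (zeros f).card ^ t) * S.card ^ t :=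
            Nat.mul_le_mul_right _ h1
        _ = ∑ f ∈ 𝒞, (zeros f).card ^ t * S.card ^ t := Finset.sum_mul _ _ _
        _ ≤ ∑ f ∈ 𝒞, (d * S.card ^ n) ^ t := Finset.sum_le_sum fun f hf => by
            rw [← mul_pow]; exact Nat.pow_le_pow_left (hzeros f hf) t
        _ = 𝒞.card * (d * S.card ^ n) ^ t := by rw [Finset.sum_const, smul_eq_mul]
    have h6 : bad.card * S.card ^ t < Ω.card * S.card ^ t := by
      calc bad.card * S.card ^ t ≤ 𝒞.card * (d * S.card ^ n) ^ t := h3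
        _ = 𝒞.card * d ^ t * (S.card ^ n) ^ t := by rw [mul_pow, mul_assoc]
        _ < S.card ^ t * (S.card ^ n) ^ t := by
            have hpos : 0 < (S.card ^ n) ^ t := by
              rcases Nat.eq_zero_or_pos t with ht | ht
              · rw [ht, pow_zero]; exact Nat.one_pos
              · by_cases hS : S.card = 0
                · rw [hS, zero_pow (by omega)] at hcount; exact absurd hcount (Nat.not_lt_zero _)
                · positivity
            exact Nat.mul_lt_mul_of_pos_right hcount hpos
        _ = Ω.card * S.card ^ t := by rw [hΩ, mul_comm]
    exact Nat.lt_of_mul_lt_mul_right h6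
  obtain ⟨ω, hωΩ, hωbad⟩ : ∃ ω ∈ Ω, ω ∉ bad := by
    by_contra hcon
    push Not at hcon
    exact absurd (Finset.card_le_card hcon) (not_le.mpr hbad)
  have hωG : ∀ k, ω k ∈ G := fun k => Fintype.mem_piFinset.mp hωΩ k
  refine ⟨Finset.univ.image ω, ?_, ?_, ?_⟩
  · intro a ha i
    obtain ⟨k, -, rfl⟩ := Finset.mem_image.mp ha
    exact Fintype.mem_piFinset.mp (hωG k) i
  · exact Finset.card_image_le.trans (by simp)
  · intro f hf
    by_contra hall
    push Not at hall
    apply hωbad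
    refine Finset.mem_biUnion.mpr ⟨f, hf, Fintype.mem_piFinset.mpr fun k => ?_⟩
    simp only [zeros, Finset.mem_filter]
    exact ⟨hωG k, hall (ω k) (Finset.mem_image.mpr ⟨k, Finset.mem_univ _, rfl⟩)⟩

end FiniteClass

end Literature.Computability.AlgebraicComplexity

end
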